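import Summits.CriticalPhenomena.SAWScalingLimit.Theses.SAWDevelopingMap
import Summits.CriticalPhenomena.SAWScalingLimit.Theorems.NoFoldBound.Negative.SingletonTightness
import Literature.Probability.RandomPlanarGeometry.HexDomainSingleton
import Literature.Probability.RandomPlanarGeometry.HexParafermionTransport
import Literature.Barriers.CriticalPhenomena.ParafermionicHalfCauchyRiemann

/-!
# Disproof of `InteriorFlattening` — findings (standing disprover, generation 2)

Crux stmt-CriticalPhenomena-8297 = `Summit.CriticalPhenomena.SAWScalingLimit.Theses.SAWDevelopingMap.InteriorFlattening`,
(M) of route SAWDevelopingMap: `∀ ε > 0 ∃ R ∀ Λ` simply connected `∀ a ∈ ∂Λ ∀ v ∈ Λ` with the Euclidean `R`-ball of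
lattice vertices of `v` inside `Λ`, for all labellings `w₀ w₁ w₂` of the neighbours:
`‖F{v,w₀} + ωF{v,w₁} + ω²F{v,w₂}‖ ≤ ε‖F{v,w₀} + F{v,w₁} + F{v,w₂}‖`, `F = F(a,·,x_c,5/8)` the DCS observable.
(Lattice scale: hexagon-centre spacing `1`, honeycomb edge `1/√3`; ball radii `1/√3, 1, 2/√3, √(7/3), …`.)

VERDICT SO FAR: no kill; (M) resists every cheap attack and — by the bookkeeping of §C below — is expected TRUE
with rate `|μ_v| ≍ C/R` (no plateau is possible in any conformally invariant scaling limit at `c = 0`).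
What IS killed / proved, and what a proof must therefore use, is indexed here; Lean content below, prose in
docstrings only.  Generation-1 files (cycle 1, seat refuter-cdisprove-stmt-CriticalPhenomena-8297-0) live under
`run/gate/evidence/stmt-CriticalPhenomena-8297/` (not mounted in later jails); their Lean content is re-derived here.

## A. Load-bearing hypotheses (Lean, §1; landing as `Theorems/InteriorFlattening/Negative/DepthLoadBearing.lean`)
* DEPTH is load-bearing: `interiorFlattening_false_without_depth` — delete "the `R`-ball of `v` lies in `Λ`" and
  (M) is false at `ε = 1/2` on `{V0}` (source triple: sum `α_T = 1.8587`, Beltrami `β_T = 1.1413`, quotient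
  `0.6140`).  Depth tightness `flatAtDepth_inv_sqrt_three_le`: `R(ε) ≥ 1/√3` for `ε ≤ 1/2`.  NUMERICALLY the same
  quotient `β_T/α_T` persists on the whole `R = 1` ball (10 vertices, a TREE: every walk to the ports of `v` is a
  corridor through one neighbour), so in fact `R(ε) ≥ 2/√3` for `ε < 0.614` (tools/hexobs.py; not yet in Lean —
  needs the walk classification of the 10-vertex tree, cf. `NoFoldBound/Negative/Ring12Classify`).
* QUANTIFIER ORDER carries all content: `interiorFlatteningNonUniform_holds` — `∀ Λ ∀ a ∃ R ∀ v` is vacuously true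
  (`R := Σ_w dist(c u, c w)` for the outer endpoint `u` of the root).  An `R` depending on the domain proves nothing.
* `v ∈ Λ` is implied by the ball hypothesis for `R ≥ 0` (`mem_of_ball`); `a ∈ ∂Λ` is morally load-bearing (an interior
  root adjacent to `v` reproduces the source triple at any depth, up to returning loops of critical weight
  `Z_ret`; rigorous only modulo a bound `Z_ret < (3β_T - α_T)/8 = 0.196`, cf. the open support item SourceLoopBound) —
  recorded, not formalised (nobody drops it).
* SIMPLE CONNECTIVITY is conjecturally load-bearing (§3, `sorry`): two macroscopically distinct access routes to the
  ball around `v` superpose two triples with a relative phase and cancel the sum mode while the Beltrami modes add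
  (amplification `2+√3` with two ports; gen-1 exact numerics: `|μ| = 1.49` in two-corridor holed domains).  The formal
  small case of the mechanism is LANDED for the sister crux: `NoFoldBound/Negative/Ring12Refutation`
  (`noFoldBound_false_without_simplyConnected`, quotient `cot 15° · β_T/α_T = 2.29` at the antipode of the 12-ring).
  For (M) a refutation without simple connectivity needs such a witness at EVERY depth `R` — a family, not a finite
  computation; open.  In a simply connected `Λ ⊇ B_R(v)` two routes with different winding classes cannot exist
  (the region between them is a hole unless filled, and filled it is one fat route): this is WHY interference does
  not bite (M) — see §C.

## B. The barrier made specific: vertex relations + boundary values are BLIND to (M) (Lean, §2; landing as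
`Theorems/InteriorFlattening/Negative/KernelBlindness.lean`)
* `modes_free`: for every `Λ` containing the hexagons around `y` and `y + e₀`, every solution `F` of ALL vertex
  relations of `Λ` (e.g. the observable, Lemma 1) and every `(s, β) ∈ ℂ²` there is `G` with the same relations, the
  same boundary values (indeed `G = F` off twelve mid-edges) and sum mode `s`, Beltrami mode `β` at `v = (y,0)`;
  witness `F + t₁ w_y + t₂ w_{y+e₀}` with the kernel elements of `ParafermionicHalfCauchyRiemann` (triples at `v`:
  `(0, (1-ζ)/3, 1/3)` and `(-ζ/3, 0, -1/3)` on `(A,B,C)`, both with DCS mode `0`, determinant `-(1+ζ)/3`).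
* `flattening_invisible_to_vertex_relations`: with `(s,β) = (0,1)` the flattening inequality fails for EVERY `ε` at any
  depth.  So a proof of (M) must use the walk expansion (positivity of the winding law, §C), not the linear algebra
  of Lemma 1 — at every depth, uniformly.  (Sharpens `exists_sameRelations_sameBoundary_circulation_eq`: one hexagon
  frees one circulation; two hexagons free both modes at their common vertex.)
* `relation_iff_ccw_mode`: for ANY function on mid-edges the vertex relation at `v` is `F_A + ωF_B + ω²F_C = 0`
  (directions `v→A,B,C` are `a, ωa, ω²a`): the three counter-clockwise labellings of (M) are free, the three
  clockwise ones carry `|μ_v|` (gen-1 `interiorFlattening_iff_cw`, here for arbitrary solutions).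

## C. Why (M) resists — structure a prover can use (analysis; not formalised)
1. WINDING-LAW FORM (triage r1-3 KEY IDENTITY, re-derived): write every walk `a → port` with its lifted final
   direction `Θ ∈ θ₀ + (π/3)ℤ` (`θ₀` = direction `v → w₀`); `Θ mod 2π` determines the port AND the side of arrival
   (from `v`: `Θ ≡ θ_j`; from `w_j`: `Θ ≡ θ_j + π`), with `j(kπ/3) ≡ -k (mod 3)`.  With the POSITIVE winding law
   `G_Θ = Σ_{γ : Θ(γ) = Θ} x_c^{ℓ(γ)}` and `ĝ(s) = Σ_Θ e^{-isΘ} G_Θ`:  sum mode `S = e^{iσθ_a} ĝ(σ)`, Beltrami mode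
   `B = e^{iσθ_a} ĝ(σ - 2)`, DCS mode `D = e^{iσθ_a} ĝ(σ + 2) = 0` (`σ = 5/8`; spins are defined mod 6, and the
   from-`v`/from-`w` parity `(-1)^k = e^{3iΘ}` aliases `s ↔ s + 3`).  (M) at `v` ⟺ `|ĝ(-11/8)| ≤ ε |ĝ(5/8)|` for ONE
   finitely supported law `G ≥ 0`: two characters of the same positive measure, at `82.5°` and `-37.5°` per `60°` step.
2. NO INTERFERENCE IN SIMPLY CONNECTED DOMAINS: by first entrance into `B = B_R(v)`,
   `F_Λ(p) = Σ_{(b,γ_out)} x_c^{|γ_out|} e^{-iσW(γ_out)} F_{Λ∖γ_out, b}(p)` — the triple at `v` is a complex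
   superposition of triples of OTHER admissible configurations (`Λ∖γ_out ⊇ B` simply connected, root `b ∈ ∂B`).  The
   cone `{|B| ≤ ε|S|}` is not convex, so (M) for balls does not formally give (M) for `Λ`; what saves it is that in
   a simply connected `Λ` the winding `W(γ_out)` of an access path is determined up to the path's own wiggling (no
   two homotopy classes around `B`: the complement is connected), so the phases `e^{-iσW}` of the dominant entrances
   are coherent at scale `R`.  With a hole, two classes differing by `2π` in winding give relative phase `e^{∓5iπ/4}`
   and the cancellation of §A (simple connectivity item).  Adversarial simply connected far fields (108 pockets /
   collars, planner kit j005678) never exceeded the worst single-mouth ball value `0.40`.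
3. RATE AND ABSENCE OF A PLATEAU (Coulomb-gas bookkeeping, heuristic but rigid): expand the arrival amplitude in
   scaling fields of the `σ`-twisted sector, `G_Θ ≈ Σ_k c_k^{(parity Θ)} e^{i s_k Θ} ⟨Φ_k(v)⟩`.  Then `S` collects spins
   `s_k ≡ σ (mod 3)` (leading: the parafermion `ψ`, `Δ = 5/8`), `B` collects `s_k ≡ σ + 1 (mod 3)`, `D` collects
   `s_k ≡ σ - 1 (mod 3)` (absent: Lemma 1).  The leading `B`-field is the DESCENDANT `∂ψ` (`Δ = 13/8`): this is the
   trivial piecewise-linear gradient `Σ_j e^{-i(θ_j-θ₀)} ρ e^{iθ_j} f' = 3ρ e^{iθ₀} f'`, giving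
   `|μ_v| ≈ ρ_eff |f'/f| = ρ_eff (5/8)|φ''/φ'|(v) ≤ ρ_eff · (5/2)/R` UNIFORMLY over simply connected `Λ ⊇ B_R(v)` and
   roots `a` (Koebe distortion for the univalent `φ|B_R(v)`; the pole at `a` lies outside the ball).  Next: the
   winding-charge alias `s = σ - 2 = -11/8`, endpoint dimension `Δ(s) = 5/48 + (4/3)s² = 21/8` (the quadratic that
   makes `h̄(σ) = (Δ(σ) - σ)/2 = 0` exactly at `σ = 5/8`, second root `1/8`), relative size `R^{-2}`; composites with
   the energy operator `ε = Φ_{1,3}` (`Δ = 2/3`, spin 0) are `S`-type (`R^{-2/3}` corrections to `F` itself, orientation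
   blind), `:∂ε ψ:` is `B`-type at `R^{-5/3}`.  A PLATEAU `|μ| → ε₀ > 0` would need a `B`-type field of total dimension
   exactly `5/8`, i.e. `h + h̄ = 5/8` with `h - h̄ ∈ {13/8, -11/8, …}` — impossible with Kac weights `≥ -1/24` at
   `c = 0`.  So in every conformally invariant scenario `sup_{Λ,a} |μ_v| ≍ C/R → 0`: (M) true with `R(ε) ≍ C/ε`.
   Numerics agree: worst-root ball-centre `|μ| = 0.3965, 0.2657, 0.2009, 0.1995, 0.1700, 0.1380` at `R = 2,3,4,5,6,8`
   (KM seat, exact + Berretti–Sokal MC), `R|μ| ≈ 0.8 → 1.1`; the bare `ρ = 1/(2√3)` predicts `0.36/R`, the excess is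
   the outward shift of the effective port position (from-`w` arrivals) plus pre-asymptotic `R^{-5/3}, R^{-2}` terms.
   CONSEQUENCE FOR DISPROVERS: a substantive kill of (M) is a kill of conformal invariance of the critical hexagonal
   SAW itself; no lattice-level obstruction of FK-Ising type exists (there the edge values are exact projections,
   `ψ` and `ψ̄` having equal dimension `1/2`; here `ψ̄`-type partners of `ψ_{5/8}` sit at `Δ = 21/8`).
4. WHAT A PROOF MUST THEREFORE CONTROL (from B + C1): positivity/spreading of ONE winding law per vertex — a
   quantitative statement that `G_Θ` is not concentrated on an arithmetic progression of sheets fine enough to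
   resonate at `82.5°`/step while not at `37.5°`/step.  PortEqualisation (`|F(p₀)| ≈ |F(p₁)| ≈ |F(p₂)|`) is FALSE
   numerically (gen-1: min/max port magnitude `0.13–0.20`, growing `ω`-mode of first arrivals) and unnecessary.

## D. Repairs / variants that survive everything here (for planners)
(M′) sup-normalised: `‖Beltrami(v)‖ ≤ ε · sup_{v' ∈ B_{R/2}(v)} ‖Sum(v')‖`; (M″) mesoscopic `L²`: the `ℓ²`-mass of
Beltrami modes over `B_{R/2}(v)` is `≤ ε²` times that of sum modes.  Both follow from (M), both suffice for the qc
"good approximation" lemma the route needs (AIM Lemma 5.3.5 is an in-measure statement), both are immune to a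
hypothetical isolated near-zero of the sum mode.  Exact vanishing `Sum(v) = 0` with `Beltrami(v) ≠ 0` at a deep
vertex would kill (M) as typed for every `ε`; no instance is known (`|Sum| ≥ 0.31` in units of the entrance
amplitude on all balls to `R = 1.73` here; `f = (φ')^{5/8}` has no zeros), but (M′)/(M″) do not care.

## E. Targets
No stuck stubs were handed over (payload.stuck_stubs = []).  Nothing to kill.

## Census of attacks (this generation)
depth-drop (Lean, killed) · order-swap (Lean, vacuous) · kernel/barrier reduction (Lean, blind: NEW) · labelling
read-back (Lean) · SC-drop (conjectural, mechanism landed for NoFoldBound on the 12-ring) · interior root (morally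
killed modulo `Z_ret < 0.196`) · plateau scenario (excluded by Kac bound at `c = 0`, §C3) · far-field amplification
(numerics of gen-1/ideator-2: none) · exact `Sum = 0` (none found; repaired forms immune) · R = 1 tree tightness
(numerical `0.614`, Lean pending).
-/

noncomputable section

open Literature.Probability.LatticeModels Literature.Probability.RandomPlanarGeometry.SAW
open Literature.Barriers.CriticalPhenomena Literature.Barriers.CriticalPhenomena.HexKernel

namespace Summit.CriticalPhenomena.SAWScalingLimit.Cruxes.InteriorFlattening.Disproof

/-! # §1 Load-bearing hypotheses: depth, quantifier order (landing copy: `Negative/DepthLoadBearing.lean`) -/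

open Summit.CriticalPhenomena.SAWScalingLimit.Theses.SAWDevelopingMap
open Summit.CriticalPhenomena.SAWScalingLimit.Theorems

/-! ## §0 Read-back -/

/-- The body of (M) at tolerance `ε` and depth `R`: the flattening inequality at every vertex whose
Euclidean `R`-ball of lattice vertices lies in the (simply connected) domain, for every boundary root and
every labelling. [folklore] -/
def FlatAtDepth (ε R : ℝ) : Prop :=
  ∀ (Λ : Finset HexVertex), hexDomainSimplyConnected Λ → ∀ a ∈ hexDomainBoundary Λ, ∀ v ∈ Λ,
    (∀ w : HexVertex, dist (hexCenter w) (hexCenter v) ≤ R → w ∈ Λ) →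
    ∀ w₀ w₁ w₂ : HexVertex, hexGraph.Adj v w₀ → hexGraph.Adj v w₁ → hexGraph.Adj v w₂ →
    w₀ ≠ w₁ → w₁ ≠ w₂ → w₀ ≠ w₂ →
    let F : Sym2 HexVertex → ℂ := hexParafermionicObservable Λ a hexCriticalFugacity (5 / 8)
    let ω : ℂ := Complex.exp (2 * Real.pi * Complex.I / 3)
    ‖F s(v, w₀) + ω * F s(v, w₁) + ω ^ 2 * F s(v, w₂)‖ ≤
      ε * ‖F s(v, w₀) + F s(v, w₁) + F s(v, w₂)‖

/-- READ-BACK: the crux is `∀ ε > 0, ∃ R, FlatAtDepth ε R`, definitionally. [folklore] -/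
theorem interiorFlattening_iff : InteriorFlattening ↔ ∀ ε : ℝ, 0 < ε → ∃ R : ℝ, FlatAtDepth ε R :=
  Iff.rfl

/-- The hypothesis `v ∈ Λ` of (M) is redundant once `0 ≤ R`: `v` lies in its own `R`-ball. [folklore] -/
theorem mem_of_ball {Λ : Finset HexVertex} {v : HexVertex} {R : ℝ} (hR : 0 ≤ R)
    (hball : ∀ w : HexVertex, dist (hexCenter w) (hexCenter v) ≤ R → w ∈ Λ) : v ∈ Λ :=
  hball v (by simpa using hR)

/-! ## §1 The depth hypothesis cannot be dropped -/

/-- (M) with the depth hypothesis "the `R`-ball of `v` lies in `Λ`" DELETED (then `R` plays no role and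
disappears): the flattening inequality at every vertex of every simply connected domain, for every `ε > 0`.
[folklore] -/
def InteriorFlatteningWithoutDepth : Prop :=
  ∀ ε : ℝ, 0 < ε → ∀ (Λ : Finset HexVertex), hexDomainSimplyConnected Λ → ∀ a ∈ hexDomainBoundary Λ,
    ∀ v ∈ Λ, ∀ w₀ w₁ w₂ : HexVertex, hexGraph.Adj v w₀ → hexGraph.Adj v w₁ → hexGraph.Adj v w₂ →
    w₀ ≠ w₁ → w₁ ≠ w₂ → w₀ ≠ w₂ →
    let F : Sym2 HexVertex → ℂ := hexParafermionicObservable Λ a hexCriticalFugacity (5 / 8)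
    let ω : ℂ := Complex.exp (2 * Real.pi * Complex.I / 3)
    ‖F s(v, w₀) + ω * F s(v, w₁) + ω ^ 2 * F s(v, w₂)‖ ≤
      ε * ‖F s(v, w₀) + F s(v, w₁) + F s(v, w₂)‖

/-- The flattening inequality FAILS at tolerance `ε ≤ 1/2` on the one-vertex domain `{V0}`, root `{U0, V0}`,
labelling `(U0, N2, N1)`: there the Beltrami mode is `β_T`, the sum mode `α_T`, and `α_T < 2β_T`. [folklore] -/
theorem not_flat_singleton {ε : ℝ} (hε : ε ≤ 1 / 2) :
    ¬ (let F : Sym2 HexVertex → ℂ := hexParafermionicObservable ({(((0 : Site 2)), (0 : Fin 2))} : Finset HexVertex)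
          s((((0 : Site 2)), (1 : Fin 2)), (((0 : Site 2)), (0 : Fin 2))) hexCriticalFugacity (5 / 8)
       let ω : ℂ := Complex.exp (2 * Real.pi * Complex.I / 3)
       ‖F s((((0 : Site 2)), (0 : Fin 2)), (((0 : Site 2)), (1 : Fin 2))) +
          ω * F s((((0 : Site 2)), (0 : Fin 2)), ((-(Pi.single 1 1 : Site 2)), (1 : Fin 2))) +
          ω ^ 2 * F s((((0 : Site 2)), (0 : Fin 2)), ((-(Pi.single 0 1 : Site 2)), (1 : Fin 2)))‖ ≤
        ε * ‖F s((((0 : Site 2)), (0 : Fin 2)), (((0 : Site 2)), (1 : Fin 2))) +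
          F s((((0 : Site 2)), (0 : Fin 2)), ((-(Pi.single 1 1 : Site 2)), (1 : Fin 2))) +
          F s((((0 : Site 2)), (0 : Fin 2)), ((-(Pi.single 0 1 : Site 2)), (1 : Fin 2)))‖) := by
  dsimp only
  rw [nfb_triple_beltrami, nfb_triple_sum, Complex.norm_real, Complex.norm_real,
    Real.norm_of_nonneg nfb_betaT_nonneg, Real.norm_of_nonneg nfb_alphaT_pos.le]
  intro h
  have hα := nfb_alphaT_pos
  have h2 := nfb_alphaT_lt_two_betaT
  nlinarith

/-- **The depth hypothesis of `InteriorFlattening` is load-bearing**: with the `R`-ball hypothesis deleted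
the statement is false (witness `ε = 1/2`, `Λ = {V0}`, `a = {U0, V0}`, `v = V0`, labelling `(U0, N2, N1)`,
quotient `β_T/α_T = 0.614… > 1/2`). Any proof of (M) must use that `v` is deep. [folklore] -/
theorem interiorFlattening_false_without_depth : ¬ InteriorFlatteningWithoutDepth := by
  intro h
  have h1 := h (1 / 2) (by norm_num) {(((0 : Site 2)), (0 : Fin 2))} (hexDomainSimplyConnected_singleton _)
    s((((0 : Site 2)), (1 : Fin 2)), (((0 : Site 2)), (0 : Fin 2))) nfb_src_mem_boundary
    (((0 : Site 2)), (0 : Fin 2)) (by simp)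
    (((0 : Site 2)), (1 : Fin 2)) ((-(Pi.single 1 1 : Site 2)), (1 : Fin 2)) ((-(Pi.single 0 1 : Site 2)), (1 : Fin 2))
    nfb_adj_V0_U0 nfb_adj_V0_N2 nfb_adj_V0_N1 nfb_U0_ne_N2 nfb_N2_ne_N1 nfb_U0_ne_N1
  exact not_flat_singleton (le_refl _) h1

/-! ## §2 Depth tightness at the first radius -/

/-- For `R < 1/√3` the `R`-ball of lattice vertices around `v` is `{v}`: the ball hypothesis holds for the
one-vertex domain. [folklore] -/
theorem ball_singleton {R : ℝ} (hR : R < (Real.sqrt 3)⁻¹) (v : HexVertex) :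
    ∀ w : HexVertex, dist (hexCenter w) (hexCenter v) ≤ R → w ∈ ({v} : Finset HexVertex) := by
  intro w hw
  rw [Finset.mem_singleton]
  exact eq_of_dist_hexCenter_lt (hw.trans_lt hR)

/-- **Depth tightness**: if the body of (M) holds at tolerance `ε ≤ 1/2` and depth `R`, then `R ≥ 1/√3`
(the honeycomb edge length): otherwise the singleton witness of §1 is admissible. So `R(ε) ≥ 1/√3` for
every `ε ≤ 1/2` (indeed for every `ε < β_T/α_T`). [folklore] -/
theorem flatAtDepth_inv_sqrt_three_le {ε R : ℝ} (hε : ε ≤ 1 / 2) (h : FlatAtDepth ε R) :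
    (Real.sqrt 3)⁻¹ ≤ R := by
  refine le_of_not_gt fun hR => ?_
  have h1 := h {(((0 : Site 2)), (0 : Fin 2))} (hexDomainSimplyConnected_singleton _)
    s((((0 : Site 2)), (1 : Fin 2)), (((0 : Site 2)), (0 : Fin 2))) nfb_src_mem_boundary
    (((0 : Site 2)), (0 : Fin 2)) (by simp) (ball_singleton hR _)
    (((0 : Site 2)), (1 : Fin 2)) ((-(Pi.single 1 1 : Site 2)), (1 : Fin 2)) ((-(Pi.single 0 1 : Site 2)), (1 : Fin 2))
    nfb_adj_V0_U0 nfb_adj_V0_N2 nfb_adj_V0_N1 nfb_U0_ne_N2 nfb_N2_ne_N1 nfb_U0_ne_N1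
  exact not_flat_singleton hε h1

/-- No depth below the edge length works at tolerance `ε ≤ 1/2`. [folklore] -/
theorem not_flatAtDepth_of_lt {ε R : ℝ} (hε : ε ≤ 1 / 2) (hR : R < (Real.sqrt 3)⁻¹) : ¬ FlatAtDepth ε R :=
  fun h => absurd (flatAtDepth_inv_sqrt_three_le hε h) (not_le.2 hR)

/-- Keyed to the crux: (M) hands every `ε ∈ (0, 1/2]` a depth `R ≥ 1/√3 > 0`. [folklore] -/
theorem interiorFlattening_depth_ge (h : InteriorFlattening) {ε : ℝ} (hε : 0 < ε) (hε' : ε ≤ 1 / 2) :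
    ∃ R : ℝ, (Real.sqrt 3)⁻¹ ≤ R ∧ FlatAtDepth ε R := by
  obtain ⟨R, hR⟩ := h ε hε
  exact ⟨R, flatAtDepth_inv_sqrt_three_le hε' hR, hR⟩

/-! ## §3 The quantifier order carries all the content -/

/-- (M) with the depth `R` chosen AFTER the domain and the root (`∀ Λ ∀ a ∃ R ∀ v …`). [folklore] -/
def InteriorFlatteningNonUniform : Prop :=
  ∀ ε : ℝ, 0 < ε → ∀ (Λ : Finset HexVertex), hexDomainSimplyConnected Λ → ∀ a ∈ hexDomainBoundary Λ,
    ∃ R : ℝ, ∀ v ∈ Λ, (∀ w : HexVertex, dist (hexCenter w) (hexCenter v) ≤ R → w ∈ Λ) →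
    ∀ w₀ w₁ w₂ : HexVertex, hexGraph.Adj v w₀ → hexGraph.Adj v w₁ → hexGraph.Adj v w₂ →
    w₀ ≠ w₁ → w₁ ≠ w₂ → w₀ ≠ w₂ →
    let F : Sym2 HexVertex → ℂ := hexParafermionicObservable Λ a hexCriticalFugacity (5 / 8)
    let ω : ℂ := Complex.exp (2 * Real.pi * Complex.I / 3)
    ‖F s(v, w₀) + ω * F s(v, w₁) + ω ^ 2 * F s(v, w₂)‖ ≤
      ε * ‖F s(v, w₀) + F s(v, w₁) + F s(v, w₂)‖

/-- For a finite domain with a boundary root `a = {u, v'}`, `u ∉ Λ`, the depth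
`R := Σ_{w ∈ Λ} dist(c u, c w)` defeats the ball hypothesis at EVERY vertex of `Λ`. [folklore] -/
theorem ball_hypothesis_fails {Λ : Finset HexVertex} {u : HexVertex} (hu : u ∉ Λ) {v : HexVertex} (hv : v ∈ Λ) :
    ¬ (∀ w : HexVertex, dist (hexCenter w) (hexCenter v) ≤ ∑ w ∈ Λ, dist (hexCenter u) (hexCenter w) → w ∈ Λ) := by
  intro h
  refine hu (h u ?_)
  exact Finset.single_le_sum (f := fun w => dist (hexCenter u) (hexCenter w)) (fun _ _ => dist_nonneg) hv

/-- **The non-uniform version is vacuously TRUE**: choosing `R` after `(Λ, a)` one takes `R` larger than the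
distance from the outer endpoint of the root to every vertex, and no vertex is `R`-deep. Hence all content
of (M) is in the order `∀ ε ∃ R ∀ Λ`: a depth depending on the domain proves nothing. [folklore] -/
theorem interiorFlatteningNonUniform_holds : InteriorFlatteningNonUniform := by
  intro ε _ Λ _ a ha
  obtain ⟨-, u, v', rfl, -, hu⟩ := ha
  refine ⟨∑ w ∈ Λ, dist (hexCenter u) (hexCenter w), ?_⟩
  intro v hv hball
  exact absurd hball (ball_hypothesis_fails hu hv)

/-- The trivial direction: (M) implies its non-uniform form. [folklore] -/
theorem interiorFlattening_imp_nonUniform (h : InteriorFlattening) : InteriorFlatteningNonUniform := by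
  intro ε hε Λ hΛ a ha
  obtain ⟨R, hR⟩ := h ε hε
  exact ⟨R, fun v hv hball => hR Λ hΛ a ha v hv hball⟩


/-! # §2 Kernel blindness (landing copy: `Negative/KernelBlindness.lean`) -/

/-! ## §0 Constants: `ζ`, `ω = ζ²`, the products `ab, ac, bc` -/

/-- `ζ² = ζ - 1` for `ζ = e^{iπ/3}`. [folklore] -/
theorem triZeta_sq : triZeta ^ 2 = triZeta - 1 := by
  rw [HV.triZeta_eq_omg]; exact HV.omg_sq

/-- `ω = e^{2πi/3} = ζ²`. [folklore] -/
theorem omega_eq_triZeta_sq : Complex.exp (2 * Real.pi * Complex.I / 3) = triZeta ^ 2 := by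
  rw [triZeta, sq, ← Complex.exp_add]
  congr 1
  ring

/-- `ab = -1/3`. [folklore] -/
theorem vecA_mul_vecB : vecA * vecB = -1 / 3 := by
  simp only [vecA, vecB]
  linear_combination (1 / 9 : ℂ) * triZeta_sq

/-- `ac = (1 - ζ)/3`. [folklore] -/
theorem vecA_mul_vecC : vecA * vecC = (1 - triZeta) / 3 := by
  simp only [vecA, vecC]
  linear_combination (-(2 : ℂ) / 9) * triZeta_sq

/-- `bc = ζ/3`. [folklore] -/
theorem vecB_mul_vecC : vecB * vecC = triZeta / 3 := by
  simp only [vecA, vecB, vecC]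
  linear_combination (-(2 : ℂ) / 9) * triZeta_sq

/-! ## §1 The two kernel elements at the edges of `v = (y, 0)`

Neighbours of `v`: `A = (y, 1)` (direction `a`), `B = (y - e₀, 1)` (direction `b = ωa`),
`C = (y - e₁, 1)` (direction `c = ω²a`). -/

variable (y : Site 2)

/-- `w_y` vanishes on the radial edge `{v, A}`. [folklore] -/
theorem wit1_A : witness y s((y, 0), (y, 1)) = 0 := witness_face_outFace y 0

/-- `w_y{v, B} = ac = (1 - ζ)/3` (hexagon edge `0`). [folklore] -/
theorem wit1_B : witness y s((y, 0), (y - unitE0, 1)) = (1 - triZeta) / 3 := by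
  rw [show s(((y, 0) : HexVertex), ((y - unitE0, 1) : HexVertex)) = edge y 0 from rfl, witness_edge]
  simp [val, vecA_mul_vecC]

/-- `w_y{v, C} = -ab = 1/3` (hexagon edge `5`, reversed). [folklore] -/
theorem wit1_C : witness y s((y, 0), (y - unitE1, 1)) = 1 / 3 := by
  rw [show s(((y, 0) : HexVertex), ((y - unitE1, 1) : HexVertex)) = edge y 5 by
    rw [edge, Sym2.eq_swap]; rfl, witness_edge]
  simp only [val, Matrix.cons_val]
  rw [vecA_mul_vecB]
  norm_num

/-- `face (y + e₀) 2 = v`. [folklore] -/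
theorem face_shift_two : face (y + unitE0) 2 = (y, 0) := by simp [face]

/-- `outFace (y + e₀) 2 = B`. [folklore] -/
theorem outFace_shift_two : outFace (y + unitE0) 2 = (y - unitE0, 1) := by simp [outFace]

/-- Edge `1` of the hexagon around `y + e₀` is `{A, v}`. [folklore] -/
theorem edge_shift_one : edge (y + unitE0) 1 = s(((y, 1) : HexVertex), ((y, 0) : HexVertex)) := by
  simp [edge, face]

/-- Edge `2` of the hexagon around `y + e₀` is `{v, C}`. [folklore] -/
theorem edge_shift_two : edge (y + unitE0) 2 = s(((y, 0) : HexVertex), ((y - unitE1, 1) : HexVertex)) := by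
  simp [edge, face]

/-- `w_{y+e₀}{v, A} = -bc = -ζ/3` (edge `1` of the shifted hexagon, reversed). [folklore] -/
theorem wit2_A : witness (y + unitE0) s((y, 0), (y, 1)) = -(triZeta / 3) := by
  rw [show s(((y, 0) : HexVertex), ((y, 1) : HexVertex)) = edge (y + unitE0) 1 by
    rw [edge_shift_one, Sym2.eq_swap], witness_edge]
  simp [val, vecB_mul_vecC]

/-- `w_{y+e₀}` vanishes on `{v, B}` (radial edge of the shifted hexagon). [folklore] -/
theorem wit2_B : witness (y + unitE0) s((y, 0), (y - unitE0, 1)) = 0 := by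
  have h := witness_face_outFace (y + unitE0) 2
  rwa [face_shift_two, outFace_shift_two] at h

/-- `w_{y+e₀}{v, C} = ab = -1/3` (edge `2` of the shifted hexagon). [folklore] -/
theorem wit2_C : witness (y + unitE0) s((y, 0), (y - unitE1, 1)) = -1 / 3 := by
  rw [← edge_shift_two, witness_edge]
  simp only [val, Matrix.cons_val]
  rw [vecA_mul_vecB]

/-! ## §2 Both modes are free -/

/-- **At fixed vertex relations and fixed boundary values, the pair (sum mode, Beltrami mode) at an interior
vertex takes EVERY value in `ℂ²`.** For `Λ ⊇` the hexagons around `y` and `y + e₀`, any solution `F` of the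
vertex relations of `Λ`, and any `s β : ℂ`, some `G` has the same relations, agrees with `F` on `∂Λ` (indeed
off the two hexagons), and has `G{v,A} + G{v,C} + G{v,B} = s`, `G{v,A} + ωG{v,C} + ω²G{v,B} = β` at
`v = (y,0)` (clockwise labelling `(A, C, B)`). [folklore] -/
theorem modes_free (Λ : Finset HexVertex) (h1 : hexagonFaces y ⊆ Λ) (h2 : hexagonFaces (y + unitE0) ⊆ Λ)
    (F : Sym2 HexVertex → ℂ) (hF : SatisfiesVertexRelations Λ F) (s β : ℂ) :
    ∃ G : Sym2 HexVertex → ℂ, SatisfiesVertexRelations Λ G ∧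
      (∀ e ∈ hexDomainBoundary Λ, G e = F e) ∧
      (∀ e, (∀ k, e ≠ edge y k) → (∀ k, e ≠ edge (y + unitE0) k) → G e = F e) ∧
      G s((y, 0), (y, 1)) + G s((y, 0), (y - unitE1, 1)) + G s((y, 0), (y - unitE0, 1)) = s ∧
      G s((y, 0), (y, 1)) + Complex.exp (2 * Real.pi * Complex.I / 3) * G s((y, 0), (y - unitE1, 1)) +
        Complex.exp (2 * Real.pi * Complex.I / 3) ^ 2 * G s((y, 0), (y - unitE0, 1)) = β := by
  -- the two coefficients (Cramer, with the inverses `3/(2-ζ) = 1+ζ`, `ζ⁻¹ = 1-ζ` written out)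
  set FA := F s((y, 0), (y, 1)) with hFA
  set FB := F s((y, 0), (y - unitE0, 1)) with hFB
  set FC := F s((y, 0), (y - unitE1, 1)) with hFC
  set t₂ : ℂ := (FA + FC + FB + (FA + triZeta ^ 2 * FC + triZeta ^ 4 * FB) - s - β) * (1 - triZeta) with ht₂
  set t₁ : ℂ := (1 + triZeta) * (s - (FA + FC + FB) + t₂ * (1 + triZeta) / 3) with ht₁
  have hw1 := witness_relations HexKernel.hexGraph_adj_iff_of_snd_eq_zero_holds
    HexKernel.not_hexGraph_adj_of_snd_eq_holds y Λ
  have hw2 := witness_relations HexKernel.hexGraph_adj_iff_of_snd_eq_zero_holds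
    HexKernel.not_hexGraph_adj_of_snd_eq_holds (y + unitE0) Λ
  refine ⟨F + t₁ • witness y + t₂ • witness (y + unitE0), (hF.add (hw1.smul t₁)).add (hw2.smul t₂),
    fun e he => ?_, fun e he1 he2 => ?_, ?_, ?_⟩
  · simp [witness_boundary y h1 e he, witness_boundary (y + unitE0) h2 e he]
  · simp [witness_eq_zero he1, witness_eq_zero he2]
  · simp only [Pi.add_apply, Pi.smul_apply, smul_eq_mul, wit1_A, wit1_B, wit1_C, wit2_A, wit2_B, wit2_C]
    rw [← hFA, ← hFB, ← hFC]
    have hz := triZeta_sq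
    linear_combination ((1 / 9 : ℂ) * FA + (2 / 9) * FB + (2 / 9) * FC - (2 / 9) * s + (1 / 9) * β +
      ((2 / 9 : ℂ) * FA + (1 / 9) * FB - (1 / 9) * s - (1 / 9) * β) * triZeta ^ 2 +
      (-(1 / 9 : ℂ) * FB + (1 / 9) * FC) * triZeta ^ 4 + ((1 / 9 : ℂ) * FB) * triZeta ^ 6) * hz
  · simp only [Pi.add_apply, Pi.smul_apply, smul_eq_mul, wit1_A, wit1_B, wit1_C, wit2_A, wit2_B, wit2_C,
      omega_eq_triZeta_sq]
    rw [← hFA, ← hFB, ← hFC]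
    have hz := triZeta_sq
    linear_combination ((FA - β) + ((1 / 3 : ℂ) * FA - (1 / 3) * FB - (1 / 3) * FC + (1 / 3) * s - (2 / 3) * β) * triZeta +
      (-(7 / 9 : ℂ) * FA - (5 / 9) * FB + (4 / 9) * FC + (5 / 9) * s + (2 / 9) * β) * triZeta ^ 2 +
      (-(5 / 9 : ℂ) * FA - (1 / 9) * FB + (5 / 9) * FC + (1 / 9) * s + (4 / 9) * β) * triZeta ^ 3 +
      (-(1 / 9 : ℂ) * FA + (10 / 9) * FB - (1 / 9) * FC - (1 / 9) * s + (2 / 9) * β) * triZeta ^ 4 +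
      ((2 / 9 : ℂ) * FA + (7 / 9) * FB - (1 / 3) * FC - (1 / 9) * s - (1 / 9) * β) * triZeta ^ 5 +
      ((2 / 9 : ℂ) * FA - (1 / 9) * FB - (1 / 9) * FC - (1 / 9) * s - (1 / 9) * β) * triZeta ^ 6 +
      (-(4 / 9 : ℂ) * FB + (1 / 9) * FC) * triZeta ^ 7 + (-(2 / 9 : ℂ) * FB + (1 / 9) * FC) * triZeta ^ 8 +
      ((1 / 9 : ℂ) * FB) * triZeta ^ 9 + ((1 / 9 : ℂ) * FB) * triZeta ^ 10) * hz

/-- **The flattening inequality of (M) is invisible to the vertex relations and the boundary values, at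
every depth and for every tolerance.** For `Λ ⊇` the hexagons around `y`, `y + e₀` (e.g. any domain whose
`R`-ball around `v = (y,0)` is in `Λ`, `R ≥ 2/√3`) and any solution `F` of all vertex relations of `Λ` (e.g.
the observable `F(a, ·, x_c, 5/8)`, by Lemma 1), there is `G` with the same relations and the same boundary
values for which `‖G{v,A} + ωG{v,C} + ω²G{v,B}‖ ≤ ε‖G{v,A} + G{v,C} + G{v,B}‖` fails for EVERY real `ε`
(sum mode `0`, Beltrami mode `1`). [folklore] -/
theorem flattening_invisible_to_vertex_relations (Λ : Finset HexVertex) (h1 : hexagonFaces y ⊆ Λ)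
    (h2 : hexagonFaces (y + unitE0) ⊆ Λ) (F : Sym2 HexVertex → ℂ) (hF : SatisfiesVertexRelations Λ F) :
    ∃ G : Sym2 HexVertex → ℂ, SatisfiesVertexRelations Λ G ∧ (∀ e ∈ hexDomainBoundary Λ, G e = F e) ∧
      ∀ ε : ℝ, ¬ (let ω : ℂ := Complex.exp (2 * Real.pi * Complex.I / 3)
        ‖G s((y, 0), (y, 1)) + ω * G s((y, 0), (y - unitE1, 1)) + ω ^ 2 * G s((y, 0), (y - unitE0, 1))‖ ≤
          ε * ‖G s((y, 0), (y, 1)) + G s((y, 0), (y - unitE1, 1)) + G s((y, 0), (y - unitE0, 1))‖) := by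
  obtain ⟨G, hG, hb, -, hs, hβ⟩ := modes_free y Λ h1 h2 F hF 0 1
  refine ⟨G, hG, hb, fun ε h => ?_⟩
  dsimp only at h
  rw [hβ, hs] at h
  norm_num at h

/-! ## §3 Read-back: the relation at `v` is the counter-clockwise mode -/

/-- `c(A) - c(v) = a`, `c(B) - c(v) = b`, `c(C) - c(v) = c`, halved at the mid-edges: the three coefficients of
the vertex relation at `v = (y,0)` are `a/2, b/2, c/2` with `b = ζ²a`, `c = ζ⁴a`. [folklore] -/
theorem relation_coeffs :
    hexMidpoint s(((y, 0) : HexVertex), ((y, 1) : HexVertex)) - hexCenter (y, 0) = vecA / 2 ∧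
    hexMidpoint s(((y, 0) : HexVertex), ((y - unitE0, 1) : HexVertex)) - hexCenter (y, 0) = triZeta ^ 2 * vecA / 2 ∧
    hexMidpoint s(((y, 0) : HexVertex), ((y - unitE1, 1) : HexVertex)) - hexCenter (y, 0) = triZeta ^ 4 * vecA / 2 := by
  have hz := triZeta_sq
  refine ⟨?_, ?_, ?_⟩
  · simp only [hexMidpoint_mk, hexCenter, vecA, Fin.val_zero, Fin.val_one]
    push_cast
    ring
  · simp only [hexMidpoint_mk, hexCenter, HexKernel.triEmbed_sub, triEmbed_unitE0, vecA, Fin.val_zero,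
      Fin.val_one]
    push_cast
    linear_combination (-(triZeta + 2) / 6) * hz
  · simp only [hexMidpoint_mk, hexCenter, HexKernel.triEmbed_sub, triEmbed_unitE1, vecA, Fin.val_zero,
      Fin.val_one]
    push_cast
    linear_combination (-(triZeta ^ 3 + 2 * triZeta ^ 2 + triZeta - 1) / 6) * hz

/-- **The vertex relation at `v` is the vanishing of the counter-clockwise mode.** For ANY function `F` on
mid-edges: `(mid{v,A} - c(v))F{v,A} + (mid{v,B} - c(v))F{v,B} + (mid{v,C} - c(v))F{v,C} = 0` iff
`F{v,A} + ωF{v,B} + ω²F{v,C} = 0`. Hence in (M) the three counter-clockwise labellings are settled by Lemma 1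
and only the clockwise ones (`(A,C,B)` and its rotations, Beltrami modes `β, ωβ, ω²β`) carry content. [folklore] -/
theorem relation_iff_ccw_mode (F : Sym2 HexVertex → ℂ) :
    (hexMidpoint s(((y, 0) : HexVertex), ((y, 1) : HexVertex)) - hexCenter (y, 0)) * F s((y, 0), (y, 1)) +
      (hexMidpoint s(((y, 0) : HexVertex), ((y - unitE0, 1) : HexVertex)) - hexCenter (y, 0)) * F s((y, 0), (y - unitE0, 1)) +
      (hexMidpoint s(((y, 0) : HexVertex), ((y - unitE1, 1) : HexVertex)) - hexCenter (y, 0)) * F s((y, 0), (y - unitE1, 1)) = 0 ↔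
    F s((y, 0), (y, 1)) + Complex.exp (2 * Real.pi * Complex.I / 3) * F s((y, 0), (y - unitE0, 1)) +
      Complex.exp (2 * Real.pi * Complex.I / 3) ^ 2 * F s((y, 0), (y - unitE1, 1)) = 0 := by
  obtain ⟨hA, hB, hC⟩ := relation_coeffs y
  rw [hA, hB, hC, omega_eq_triZeta_sq, ← pow_mul]
  have ha : vecA / 2 ≠ 0 := div_ne_zero vecA_ne_zero two_ne_zero
  constructor
  · intro h
    apply mul_left_cancel₀ ha
    linear_combination h
  · intro h
    linear_combination (vecA / 2) * h


/-! # §3 Conjectural: simple connectivity is load-bearing (near-miss, `sorry` permitted in this work file only) -/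

/-- (M) with `hexDomainSimplyConnected Λ` DELETED. [folklore] -/
def InteriorFlatteningWithoutSC : Prop :=
  ∀ ε : ℝ, 0 < ε → ∃ R : ℝ, ∀ (Λ : Finset HexVertex), ∀ a ∈ hexDomainBoundary Λ, ∀ v ∈ Λ,
    (∀ w : HexVertex, dist (hexCenter w) (hexCenter v) ≤ R → w ∈ Λ) →
    ∀ w₀ w₁ w₂ : HexVertex, hexGraph.Adj v w₀ → hexGraph.Adj v w₁ → hexGraph.Adj v w₂ →
    w₀ ≠ w₁ → w₁ ≠ w₂ → w₀ ≠ w₂ →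
    let F : Sym2 HexVertex → ℂ := hexParafermionicObservable Λ a hexCriticalFugacity (5 / 8)
    let ω : ℂ := Complex.exp (2 * Real.pi * Complex.I / 3)
    ‖F s(v, w₀) + ω * F s(v, w₁) + ω ^ 2 * F s(v, w₂)‖ ≤
      ε * ‖F s(v, w₀) + F s(v, w₁) + F s(v, w₂)‖

/-- NEAR-MISS (conjectural, NOT proved): without simple connectivity (M) should fail by two-route interference —
a ball `B_R(v)` fed through two corridors whose access windings differ by `2π` superposes two triples with relative
phase `e^{∓5πi/4}`; tuning corridor lengths cancels the sum mode while Beltrami modes add (amplification `2 + √3`,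
gen-1 exact numerics `|μ| = 1.49`; formal 12-ring instance for the sister crux:
`NoFoldBound.Negative.noFoldBound_false_without_simplyConnected`, quotient `2.29`).  OBSTRUCTION to a proof here: the
statement keeps `∃ R`, so a witness is needed at EVERY depth `R` — an infinite family of holed domains whose
observable at the centre must be controlled analytically (the corridor transfer matrix is explicit, the ball part is
not).  Tried: nothing formal beyond the mechanism; a proof would need (M) itself on balls (to know the two triples
being superposed) — circular for a disprover.  Left as the standing conjecture of this file. [folklore] -/
theorem interiorFlattening_false_without_simplyConnected : ¬ InteriorFlatteningWithoutSC := by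
  sorry

end Summit.CriticalPhenomena.SAWScalingLimit.Cruxes.InteriorFlattening.Disproof

end
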